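import Mathlib
import HarnessLib
import HarnessLib.Audit
import Summits.FinalStateConjecture.Statement
import HarnessLib.Audit.Status.Attr

/-!
Route: RootDecompAdjacencyCells

# Route RootDecompAdjacencyCells — Root decomposition N4 «MinimalCounterexampleCells» — FSC ⟺ no
stable counterexample ∧ dispersive thresholds curable ∧ settling-adherent residual curable

DECOMPOSITION CELL decomp-fsc (D-0178; doctrine D-0170/0171/0172), summit S =
`_root_.FinalStateConjecture` exactly as typed; LADDER rung 0 — NOTHING IN THIS FILE PROVES THE
FINAL STATE CONJECTURE. OR-SIBLING of the cell's file of record Theses/RootDecompCaptureCells.lean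
(route-FinalStateConjecture-RootDecompCaptureCells, N5), of Theses/RootDecompGermJunction.lean (N3)
and Theses/RootDecompCausalCells.lean (N2); this file = node N4 «MinimalCounterexampleCells» (lens
decomp-fsc-lens-4, minimal-counterexample / extremal reduction: sort the exceptional data by their
TAME ADJACENCY to the good data), CLEARED by the critic decomp-fsc-crit-1-g0 2026-08-30T01:32:59Z
(HOME/CRITIC-LEDGER.md row 01:32:59Z; HOME = run/shared/lean/pub/decomp-fsc): «exact AND ✓ necessity
✓ no EQUIV ✓ T1/T2/T5 clean; attackable-now only at road level (0/3 binders); cell II is the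
RESIDUAL (relabel)». The whole AND/OR tree is kept in HOME/TREE.md.
ROOT AND-node (exact, kernel `summit_iff_cells` in the writer's folder/n4/Sketch.lean; lens
`node_iff`/`generic_iff_threeCells`): S ⟺ NoStableCounterexample ∧ DispersiveThresholdCurable ∧
SettlingAdherentCurable — a FREE POPULATION SPLIT of the exceptional set 𝓔_Σ by TAME ADHERENCE
adh(A)(d) := «some tame (order 1 on one end), immersed-at-0 curve of admissible data based at d
carries A-data at parameters ACCUMULATING at 0 (∃ᶠ c in 𝓝[≠] 0)» — the summit's own witness class,
read as the tame sequential closure: cell I = adh(G₀) (tame limits of DISPERSING data, G₀ = the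
summit property with N = 0 final holes: the collapse threshold seen from the dispersive side), cell
II = adh(G) ∖ adh(G₀) (tame limits of settling data isolated from dispersion: extremal /
merge-scatter / N-jump thresholds — the RESIDUAL), cell III = ¬adh(G) (STABLE counterexamples:
exceptional data tamely isolated from all good data) — and for cell III «curable» collapses in the
kernel to «EMPTY» (a cure is itself a curve of good data accumulating at d;
`noStableCounterexample_iff_isolatedCellEmptyCure` in Sketch.lean = lens `cellEsc_not_tameAdh_iff`),
so piece III is typed directly as TAME DENSITY of the settling data at every exceptional datum. Cure
target = P_Σ verbatim, tame genericity verbatim. Tags: NoStableCounterexample [WEAKER·COUNTS —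
kernel `noStableCounterexample_of_summit`; ⇏ S: density ⊬ tame codimension (laminated exceptional
sets: route LaminatedThreshold, RobustClausewiseGenericity.PlanarNonClosure stmt-10134, census F4);
leaf IDEA-NEEDED (every known failure mechanism is unstable in its model: Christodoulou 1999,
Aretakis, Lichnerowicz–Anderson; FALSE in neighbouring models — Klein–Gordon hair, D = 5 — so any
proof is vacuum- and dimension-specific)]; DispersiveThresholdCurable [WEAKER·thin — kernel
`dispersiveThresholdCurable_of_summit`; leaf IDEA-NEEDED + INSTRUMENTABLE (regularity of the vacuum
collapse threshold in 2-parameter families, NR 50–150 core-h, unrun); road SmoothDispersiveThreshold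
(one-sided smooth-graph access + bending lemma `cellEsc_of_graphAccess`, lens kernel) UNDECIDED,
outside closes]; SettlingAdherentCurable [WEAKER·RESIDUAL near-wholesale — kernel
`settlingAdherentCurable_of_summit`; critic: given III it is 𝓔 ∖ cell I and carries the hard cores
stmt-17269 / stmt-17308; INTERNAL NODE queued for gen 1; road SmoothHoleThreshold UNDECIDED (EMCSF
test = model analogy)]. No EQUIV layer; no ∀-data binder in `closes` (roads DispersalTamelyOpen /
SmoothDispersiveThreshold / SmoothHoleThreshold stay OUTSIDE, critic T2); no theorem-emptied cell
(T3); root genericity tame/one end/whole line (T5). Writer typing: every item is ONE line over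
EXISTING declarations (P_Σ, P₀ = P_Σ with `d.N = 0`, AdhP, Adh0 inlined with `let`),
folder/n4/Sketch.lean rc 0, 0 sorry (closes: cell III gives adherence, then excluded middle on Adh0;
necessity ×3 incl. `eventually_nhdsWithin_of_forall … .frequently` for III; `summit_iff_cells`).
Lens node file HOME/decomp-fsc-lens-4/MinimalCounterexampleCells.lean
sha256=a01835637173d3d5093fcc6db8c201a73ef16f656cee2aceedcdc88f33ab86ba (critic-checked @a0183563;
NODE line 01:26:02Z) + NODE-g0.md; instrument data HOME/census/COSTUME-CENSUS-v1.md
sha256=17660d2f90b581bafa564c3770aecf7145cb0a799b3c1f57b10d96f2c53a4c91 (rows F2 exceptional sets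
both-sides-open caution c1, F4 density vs codimension, PR4 CK93 dispersive basin bear on this node).
Why this is novel: no prior route orders the counterexamples of the typed summit by tame adjacency
to the good data — the cut turns «no stable counterexample» into an S-implied density piece and
isolates the collapse threshold seen from the dispersive side as its own cell, which no searched
paper or route does.
Lean: `NoStableCounterexample ∧ DispersiveThresholdCurable ∧ SettlingAdherentCurable` (the three
decls of this file; exactness `summit_iff_cells` kernel-checked in folder/n4/Sketch.lean)

## Assembly
Pure logic inside `closes` (folder/n4/glue.lean, 0 sorry): for an admissible exceptional datum d,
NoStableCounterexample gives tame adherence to the settling data; excluded middle on adherence to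
the dispersing data — DispersiveThresholdCurable cures the adherent case, SettlingAdherentCurable
the other — and the cure «∀ c ≠ 0, P_Σ (F c)» is repackaged as «F c ∉ {d ∈ 𝓓 | ¬P d}». Binders
consumed: all three cruxes (cone 3). Converse S ⟹ every binder: `noStableCounterexample_of_summit`
(a cure is an accumulating curve of good data: `eventually_nhdsWithin_of_forall … .frequently`),
`dispersiveThresholdCurable_of_summit`, `settlingAdherentCurable_of_summit`; exactness
`summit_iff_cells` (Sketch.lean).

Rationale: WHY THIS LINE. Population splits of the exceptional set with cure target P are free and exact
(critic `fsc_iff_cellSplit`; tame genericity monotone, not ∧-closed — tree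
`isTameChristodoulouGeneric_and_fails`), hence judged on content: the lens's order on
counterexamples is tame ADJACENCY in the summit's own curve class, which separates failure
mechanisms by how a counterexample sits relative to the good data — stable (cell III, conjecturally
empty: every catalogued mechanism is unstable in its model, Christodoulou1999 Thm 4.1 =
`Literature.Barriers.FinalStateConjecture.nakedSingularityInstability`; Aretakis; Anderson
doi:10.1007/PL00001021), at the dispersion/collapse threshold (cell I: critical collapse,
Gundlach–Martín-García arXiv:0711.4620; Luk–Oh arXiv:2108.13379 Thm 1.3 openness of dispersion among
decaying solutions; Kehle–Unger arXiv:2402.10190 B_crit), or adherent to settling data but isolated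
from dispersion (cell II: extremal, merge/scatter and N-jump thresholds, Pretorius–Khurana
gr-qc/0702084 zoom–whirl). Imported: the minimal-counterexample heuristic of extremal combinatorics
as an ORDER on data (adjacency), nothing analytic. What it does that prior routes do not:
LaminatedThreshold / RobustClausewiseGenericity study density-versus-codimension as a refutation
theme for ALL data; here density is the S-implied piece III and the two threshold cells carry the
codimension content, with typed roads (smooth one-sided graph access + a kernel bending lemma) kept
outside `closes`.

RANKED CRUXES. #2 NoStableCounterexample (crux) — PIECE III — NoStableCounterexample [WEAKER·COUNTS
— critic CLEARED 2026-08-30T01:32:59Z («tame density; counts»); kernel-equivalent to «cell III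
(exceptional data tamely isolated from all settling data) is curable»
(`noStableCounterexample_iff_isolatedCellEmptyCure`); leaf IDEA-NEEDED; BARRIER placement:
HairyKerrBifurcation / GregoryLaflammeInstability show it FALSE in neighbouring models ⇒ vacuum- and
D = 4-specific proof required]. For every Σ and every admissible datum d failing P_Σ there is a tame
(order 1 on one end), immersed-at-0 curve F of admissible data with F 0 = d carrying P_Σ-data at
parameters accumulating at 0 (∃ᶠ c in 𝓝[≠] 0, P_Σ (F c)) — the settling data are tamely dense at
every exceptional datum; no counterexample is stable. [difficulty: open-problem] (why it might fail:
an as yet unknown STABLE vacuum failure mechanism — a tame-open set of naked-singularity, hairy /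
exactly-extremal remnant, or eternal bounded-dynamics data (true in Einstein–Klein–Gordon and in D =
5; no vacuum D = 4 candidate known).) [Christodoulou1999, arXiv:1912.08478, doi:10.1007/PL00001021,
arXiv:2211.15742]
#3 DispersiveThresholdCurable (crux) — PIECE I — DispersiveThresholdCurable [WEAKER·thin — critic
CLEARED 2026-08-30T01:32:59Z; leaf IDEA-NEEDED + INSTRUMENTABLE (NR test: regularity of the vacuum
collapse threshold in 2-parameter Brill/Teukolsky-wave families, 50–150 core-h, unrun); road
SmoothDispersiveThreshold → piece (lens kernel `dispersiveThresholdCurable_of_smooth` via the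
bending lemma `cellEsc_of_graphAccess`) UNDECIDED, outside closes]. For every Σ and every admissible
P_Σ-exceptional datum d which is tamely adherent to the DISPERSING data (some tame immersed curve of
admissible data based at d carries, at parameters accumulating at 0, data all of whose MGHDs have
complete 𝓘⁺ and an honest decomposition with N = 0 final holes and the Statement's clauses), there
are one end e and a tame immersed injective one-parameter family F of admissible data with F 0 = d
whose members c ≠ 0 satisfy P_Σ. [difficulty: open-problem] (why it might fail: a laminated /
fractal vacuum collapse threshold (non-universal critical behaviour) leaves a two-sided accumulating
exceptional stratum at a critical datum which no immersed tame curve escapes (route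
LaminatedThreshold crux A).) [arXiv:0711.4620, arXiv:2108.13379, arXiv:2402.10190,
Christodoulou1999]
#4 SettlingAdherentCurable (crux) — PIECE II (RESIDUAL, relabelled per critic) —
SettlingAdherentCurable [WEAKER·RESIDUAL near-wholesale — critic CLEARED 2026-08-30T01:32:59Z:
«given III it is 𝓔 ∖ cell I: near-wholesale, carries 17269/17308 content»; INTERNAL NODE queued for
gen 1; road SmoothHoleThreshold UNDECIDED (EMCSF test = model analogy); BARRIER AretakisInstability
on the extremal-threshold part of the cell]. For every Σ and every admissible P_Σ-exceptional datum
d which is tamely adherent to the SETTLING data (P_Σ-data accumulate at 0 along some tame immersed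
admissible curve based at d) but NOT tamely adherent to the dispersing data, there are one end e and
a tame immersed injective one-parameter family F of admissible data with F 0 = d whose members c ≠ 0
satisfy P_Σ. [difficulty: open-problem] (why it might fail: an extremal critical threshold whose
sub-extremal side is not one-sidedly tame-open near the threshold (near-extremal Kerr stability
open; Aretakis), or a zoom–whirl / N-jump threshold with Cantor-like structure in the tame
topology.) [arXiv:2402.10190, arXiv:2211.15742, arXiv:gr-qc/0702084, Klainerman2025]

TWO-LAYER PLAN. Foreseen (lens kernel, not filed): DispersiveThresholdCurable ⇐
SmoothDispersiveThreshold (one-sided smooth-graph access to the dispersing data at every cell-I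
datum) via the bending lemma `cellEsc_of_graphAccess`; SettlingAdherentCurable ⇐ SmoothHoleThreshold
likewise; both roads are NOT S-implied (UNDECIDED) and would enter as support items only after the
tribunal. Gen-1 split owed on SettlingAdherentCurable (extremal thresholds / N-jumps /
merge-scatter), where the sibling nodes' cells attach (N5 EternalCell, N2 TrappedExit).

KILL CRITERIA. All three binders are S-implied in the kernel, so a refutation of any of them (a
tame-open set of stable counterexamples; a laminated two-sided threshold at a critical vacuum datum)
is a refutation of the summit AS TYPED — it closes this route `refuted:<Decl>` and feeds route
LaminatedThreshold / the statement audit, not a pivot. A refutation of a ROAD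
(SmoothDispersiveThreshold false: non-smooth but still one-sidedly escapable threshold) changes only
the layer-2 plan. Superseded if a sibling root decomposition absorbs the three cells with strictly
finer content.

NOT DECOMPOSED YET. SettlingAdherentCurable (the residual) is deliberately not decomposed at birth
(gen-1 internal node); the instrument for cell I (2-parameter threshold regularity in vacuum NR) is
stated, not run; constants none.

CHEAPEST FALSIFIER. NoStableCounterexample: a literature lookup for a STABLE vacuum D = 4 failure
mechanism (stable naked singularity, stable non-Kerr stationary or breathing exterior, stable
exactly-extremal remnant) — none in print (RSR arXiv:1912.08478 fine-tuned; Alexakis–Schlue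
arXiv:1504.04592; black-hole uniqueness literature); the writer re-ran no search beyond the N5/N2
ones (listed under Novelty). DispersiveThresholdCurable: the NR threshold-regularity test (critical
collapse of Brill waves: is the threshold a smooth one-sided hypersurface in 2-parameter families,
or laminated as suggested by non-universality reports [galaxy:pdf:4861896740]?) — unrun, kit_allowed
= false for the writer. SettlingAdherentCurable: Kehle–Unger-type extremal thresholds in the charged
model are smooth hypersurfaces met transversally (arXiv:2402.10190 Conj. 3) — consistent; a kill
needs a Cantor-structured threshold.

NUMBERS. Print only: Choptuik scaling exponent and echoing period for vacuum Brill-wave collapse are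
disputed / non-universal across families ([galaxy:pdf:4861896740]; arXiv:0711.4620 §6), which is
exactly the cell-I risk; remnant spins ≤ 0.95 on open sets (arXiv:1904.04831). No constant enters a
binder.

DEFINITION REQUESTS. None filed. `TameAdh` (tame adherence) is inlined as a `let`; if gen-1 lenses
reuse it, a Literature-level definition `InitialDataSet.IsTamelyAdherent` next to `IsTameDataFamily`
(TameGenericity.lean) would let the items be restated by name (definitionally equal). Shared Frame
for CellEsc (critic must-fix 1) concerns the HOME node files.

Novelty: Searches (2026-08-30, lens-4 + writer): the sub's Theses files read for density/threshold routes
(nearest: LaminatedThreshold, RobustClausewiseGenericity.PlanarNonClosure stmt-10134 — all-data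
refutation themes; no adjacency split); lit search --hybrid "critical collapse threshold vacuum
Brill waves universality" ([corpus:arxiv-2108.13379 Thm 1.3], [corpus:arxiv-2402.10190 p.4],
[corpus:arxiv-2601.20955 p.4]); lit galaxy search "critical collapse|Choptuik scaling|zoom-whirl"
--star all ([galaxy:pdf:4861896740] non-universal vacuum critical behaviour; textbook hits
otherwise); writer's N5/N2 searches (lit search --hybrid "orbital stability asymptotic stability
Kerr final state generic data extremal third law" 8 docs; lit galaxy search "orbitally
stable|orbital stability of Kerr|final state conjecture" --star all 17 rows; no population-split
hit); ledger negatives --problem FinalStateConjecture (no refuted statement is a cell-cure or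
density statement of this shape).
Nearest prior art found: Christodoulou1999 Thm 4.1 (instability of naked singularities = the model
of «no stable counterexample»); Kehle–Unger arXiv:2402.10190 Conj. 3 (smooth critical hypersurface);
in-tree LaminatedThreshold (density ⊬ codimension), RobustClausewiseGenericity stmt-10134.
Delta: the exceptional set of the typed summit is split, exactly and for free, by tame adjacency to
the dispersing resp. settling data, so that «no stable counterexample» becomes an S-implied
tame-density piece and the two collap  [refs: 2402.10190, arxiv-2108.13379, arxiv-2402.10190, arxiv-2601.20955, Christodoulou1999]

Barriers (technique_class: population-split, tame-adjacency, critical-collapse): - technique_class: population-split, tame-adjacency, critical-collapse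
- Literature.Barriers.FinalStateConjecture.nakedSingularityInstability: genericity-blind methods
excluded; all three pieces are GENERIC (tame-curve) forms and piece III is exactly the abstract
shape of the barrier's own theorem (instability of every counterexample) — outside the class.
- Literature.Barriers.FinalStateConjecture.AretakisInstability: bites the extremal-threshold part of
SettlingAdherentCurable (no uniform-in-spin control up to |a| = M) — declared there (IDEA-NEEDED),
not evaded; DispersiveThresholdCurable and NoStableCounterexample do not quantify over horizon
dynamics.
- Literature.Barriers.FinalStateConjecture.SlowlyRotatingKerrFrontier: printed near-Kerr basins are
not split off as a cell; the residual's closing as typed needs behaviour across the full range —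
acknowledged for roads.
- Literature.Barriers.FinalStateConjecture.HairyKerrBifurcation: NoStableCounterexample is FALSE for
Einstein–Klein–Gordon (stable hairy black holes) — the items are VACUUM only; any proof must use the
absence of massive hair (vacuum-specific), acknowledged as the piece's barrier.
- Literature.Barriers.FinalStateConjecture.GregoryLaflammeInstability: likewise FALSE-in-D = 5
analogue; items are D = 4 — dimension-specific proof required, acknowledged.
- Literature.Barriers.FinalStateConjecture.KerrSuperradiance: decay-estimate barrier for linear
roads; binders are data-side cure/density statements — outside; ro

sub-problem: FinalStateConjecture · status: draft · opened planner-decomp-fsc-writer-1-g0-0 2026-08-30T02:11:18Z · rev 1 · ledger route-FinalStateConjecture-RootDecompAdjacencyCells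
GENERATED by the gate from the ledger (D-0016/17). Provers cite these decls: `theorem foo : Summit.FinalStateConjecture.FinalStateConjecture.Theses.RootDecompAdjacencyCells.<Decl> := …` in Summits/FinalStateConjecture/FinalStateConjecture/Theorems/<Name>.lean.
-/

namespace Summit.FinalStateConjecture.FinalStateConjecture.Theses.RootDecompAdjacencyCells

open scoped BigOperators Topology Manifold Classical MeasureTheory ProbabilityTheory Matrix InnerProductSpace ComplexConjugate ContinuousMap
open Filter Set Function TopologicalSpace MeasureTheory

attribute [summit_statement] _root_.FinalStateConjecture

/-- item stmt-FinalStateConjecture-24908 · crux · rank 2 · open · by planner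
why it might fail: an as yet unknown STABLE vacuum failure mechanism — a tame-open set of naked-singularity, hairy / exactly-extremal remnant, or eternal bounded-dynamics data (true in Einstein–Klein–Gordon and in D = 5; no vacuum D = 4 candidate known).
sources: Christodoulou1999, arXiv:1912.08478, doi:10.1007/PL00001021, arXiv:2211.15742
[crux] PIECE III — NoStableCounterexample [WEAKER·COUNTS — critic CLEARED 2026-08-30T01:32:59Z
(«tame density; counts»); kernel-equivalent to «cell III (exceptional data tamely isolated from all
settling data) is curable» (`noStableCounterexample_iff_isolatedCellEmptyCure`); leaf IDEA-NEEDED;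
BARRIER placement: HairyKerrBifurcation / GregoryLaflammeInstability show it FALSE in neighbouring
models ⇒ vacuum- and D = 4-specific proof required]. For every Σ and every admissible datum d
failing P_Σ there is a tame (order 1 on one end), immersed-at-0 curve F of admissible data with F 0
= d carrying P_Σ-data at parameters accumulating at 0 (∃ᶠ c in 𝓝[≠] 0, P_Σ (F c)) — the settling
data are tamely dense at every exceptional datum; no counterexample is stable. [difficulty:
open-problem] -/
@[route_item "route-FinalStateConjecture-RootDecompAdjacencyCells", crux]
def NoStableCounterexample : Prop :=
  ∀ (X : Type) [TopologicalSpace X] [ChartedSpace Literature.Geometry.Lorentzian.E3 X] [IsManifold (𝓡 3) ((⊤ : ℕ∞) : WithTop ℕ∞) X] [T2Space X] [SecondCountableTopology X] [ConnectedSpace X], let P : Literature.Geometry.Lorentzian.InitialDataSet (𝓡 3) X → Prop := fun D ↦ (∃ 𝒟 : Literature.Geometry.Lorentzian.VacuumCauchyDevelopment D, 𝒟.IsMaximal) ∧ ∀ 𝒟 : Literature.Geometry.Lorentzian.VacuumCauchyDevelopment D, 𝒟.IsMaximal → Summit.FinalStateConjecture.HasCompleteNullInfinity 𝒟.toCauchyDevelopment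 ∧ ∃ (O : Set 𝒟.carrier) (d : Literature.Geometry.Lorentzian.FinalStateDecomposition 𝒟.toSpacetime O 2), (∀ i, Literature.Geometry.Lorentzian.Kerr.IsSubextremal (d.mass i) (d.spin i)) ∧ O = Summit.FinalStateConjecture.exteriorOf 𝒟.toCauchyDevelopment d.charted ∧ Summit.FinalStateConjecture.RaysStayInClosure 𝒟.toCauchyDevelopment O ∧ Summit.FinalStateConjecture.HasExhaustiveCharts d ∧ Summit.FinalStateConjecture.IsFutureOriented d; let AdhP : Literature.Geometry.Lorentzian.InitialDataSet (𝓡 3) X → Prop := fun d ↦ ∃ (e : Literature.Geometry.Lorentzian.AFEnd X) (F : EuclideanSpace ℝ (Fin 1) → Literature.Geometry.Lorentzian.InitialDataSet (𝓡 3) X), Literature.Geometry.Lorentzian.InitialDataSet.IsTameDataFamily e 1 F ∧ Literature.Geometry.Lorentzian.InitialDataSet.IsImmersedAtZero 1 F ∧ F 0 = d ∧ (∀ c, F c ∈ Literature.Geometry.Lorentzian.admissibleVacuumData X) ∧ ∃ᶠ c in 𝓝[≠] (0 : EuclideanSpace ℝ (Fin 1)), P (F c); ∀ d ∈ Literature.Geometry.Lorentzian.admissibleVacuumData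 X, ¬ P d → AdhP d

/-- item stmt-FinalStateConjecture-24909 · crux · rank 3 · open · by planner
why it might fail: a laminated / fractal vacuum collapse threshold (non-universal critical behaviour) leaves a two-sided accumulating exceptional stratum at a critical datum which no immersed tame curve escapes (route LaminatedThreshold crux A).
sources: arXiv:0711.4620, arXiv:2108.13379, arXiv:2402.10190, Christodoulou1999
[crux] PIECE I — DispersiveThresholdCurable [WEAKER·thin — critic CLEARED 2026-08-30T01:32:59Z; leaf
IDEA-NEEDED + INSTRUMENTABLE (NR test: regularity of the vacuum collapse threshold in 2-parameter
Brill/Teukolsky-wave families, 50–150 core-h, unrun); road SmoothDispersiveThreshold → piece (lens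
kernel `dispersiveThresholdCurable_of_smooth` via the bending lemma `cellEsc_of_graphAccess`)
UNDECIDED, outside closes]. For every Σ and every admissible P_Σ-exceptional datum d which is tamely
adherent to the DISPERSING data (some tame immersed curve of admissible data based at d carries, at
parameters accumulating at 0, data all of whose MGHDs have complete 𝓘⁺ and an honest decomposition
with N = 0 final holes and the Statement's clauses), there are one end e and a tame immersed
injective one-parameter family F of admissible data with F 0 = d whose members c ≠ 0 satisfy P_Σ.
[difficulty: open-problem] -/
@[route_item "route-FinalStateConjecture-RootDecompAdjacencyCells", crux]
def DispersiveThresholdCurable : Prop :=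
  ∀ (X : Type) [TopologicalSpace X] [ChartedSpace Literature.Geometry.Lorentzian.E3 X] [IsManifold (𝓡 3) ((⊤ : ℕ∞) : WithTop ℕ∞) X] [T2Space X] [SecondCountableTopology X] [ConnectedSpace X], let P : Literature.Geometry.Lorentzian.InitialDataSet (𝓡 3) X → Prop := fun D ↦ (∃ 𝒟 : Literature.Geometry.Lorentzian.VacuumCauchyDevelopment D, 𝒟.IsMaximal) ∧ ∀ 𝒟 : Literature.Geometry.Lorentzian.VacuumCauchyDevelopment D, 𝒟.IsMaximal → Summit.FinalStateConjecture.HasCompleteNullInfinity 𝒟.toCauchyDevelopment ∧ ∃ (O : Set 𝒟.carrier) (d : Literature.Geometry.Lorentzian.FinalStateDecomposition 𝒟.toSpacetime O 2), (∀ i, Literature.Geometry.Lorentzian.Kerr.IsSubextremal (d.mass i) (d.spin i)) ∧ O = Summit.FinalStateConjecture.exteriorOf 𝒟.toCauchyDevelopment d.charted ∧ Summit.FinalStateConjecture.RaysStayInClosure 𝒟.toCauchyDevelopment O ∧ Summit.FinalStateConjecture.HasExhaustiveCharts d ∧ Summit.FinalStateConjecture.IsFutureOriented d; let P0 : Literature.Geometry.Lorentzian.InitialDataSet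 (𝓡 3) X → Prop := fun D ↦ (∃ 𝒟 : Literature.Geometry.Lorentzian.VacuumCauchyDevelopment D, 𝒟.IsMaximal) ∧ ∀ 𝒟 : Literature.Geometry.Lorentzian.VacuumCauchyDevelopment D, 𝒟.IsMaximal → Summit.FinalStateConjecture.HasCompleteNullInfinity 𝒟.toCauchyDevelopment ∧ ∃ (O : Set 𝒟.carrier) (d : Literature.Geometry.Lorentzian.FinalStateDecomposition 𝒟.toSpacetime O 2), d.N = 0 ∧ (∀ i, Literature.Geometry.Lorentzian.Kerr.IsSubextremal (d.mass i) (d.spin i)) ∧ O = Summit.FinalStateConjecture.exteriorOf 𝒟.toCauchyDevelopment d.charted ∧ Summit.FinalStateConjecture.RaysStayInClosure 𝒟.toCauchyDevelopment O ∧ Summit.FinalStateConjecture.HasExhaustiveCharts d ∧ Summit.FinalStateConjecture.IsFutureOriented d; let Adh0 : Literature.Geometry.Lorentzian.InitialDataSet (𝓡 3) X → Prop := fun d ↦ ∃ (e : Literature.Geometry.Lorentzian.AFEnd X) (F : EuclideanSpace ℝ (Fin 1) → Literature.Geometry.Lorentzian.InitialDataSet (𝓡 3) X), Literature.Geometry.Lorentzian.InitialDataSet.IsTameDataFamily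 e 1 F ∧ Literature.Geometry.Lorentzian.InitialDataSet.IsImmersedAtZero 1 F ∧ F 0 = d ∧ (∀ c, F c ∈ Literature.Geometry.Lorentzian.admissibleVacuumData X) ∧ ∃ᶠ c in 𝓝[≠] (0 : EuclideanSpace ℝ (Fin 1)), P0 (F c); ∀ d ∈ Literature.Geometry.Lorentzian.admissibleVacuumData X, ¬ P d → Adh0 d → ∃ (e : Literature.Geometry.Lorentzian.AFEnd X) (F : EuclideanSpace ℝ (Fin 1) → Literature.Geometry.Lorentzian.InitialDataSet (𝓡 3) X), Literature.Geometry.Lorentzian.InitialDataSet.IsTameDataFamily e 1 F ∧ Literature.Geometry.Lorentzian.InitialDataSet.IsImmersedAtZero 1 F ∧ F 0 = d ∧ Injective F ∧ (∀ c, F c ∈ Literature.Geometry.Lorentzian.admissibleVacuumData X) ∧ ∀ c ≠ 0, P (F c)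

/-- item stmt-FinalStateConjecture-24910 · crux · rank 4 · SPLIT (gen 1) into RobustThresholdCurable, DegenerateThresholdCurable + glue SettlingAdherentCurableGlue · direct attempts still welcome (low priority) · by planner
why it might fail: an extremal critical threshold whose sub-extremal side is not one-sidedly tame-open near the threshold (near-extremal Kerr stability open; Aretakis), or a zoom–whirl / N-jump threshold with Cantor-like structure in the tame topology.
sources: arXiv:2402.10190, arXiv:2211.15742, arXiv:gr-qc/0702084, Klainerman2025
[crux] PIECE II (RESIDUAL, relabelled per critic) — SettlingAdherentCurable [WEAKER·RESIDUAL
near-wholesale — critic CLEARED 2026-08-30T01:32:59Z: «given III it is 𝓔 ∖ cell I: near-wholesale,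
carries 17269/17308 content»; INTERNAL NODE queued for gen 1; road SmoothHoleThreshold UNDECIDED
(EMCSF test = model analogy); BARRIER AretakisInstability on the extremal-threshold part of the
cell]. For every Σ and every admissible P_Σ-exceptional datum d which is tamely adherent to the
SETTLING data (P_Σ-data accumulate at 0 along some tame immersed admissible curve based at d) but
NOT tamely adherent to the dispersing data, there are one end e and a tame immersed injective
one-parameter family F of admissible data with F 0 = d whose members c ≠ 0 satisfy P_Σ. [difficulty:
open-problem] -/
@[route_item "route-FinalStateConjecture-RootDecompAdjacencyCells", crux]
def SettlingAdherentCurable : Prop :=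
  ∀ (X : Type) [TopologicalSpace X] [ChartedSpace Literature.Geometry.Lorentzian.E3 X] [IsManifold (𝓡 3) ((⊤ : ℕ∞) : WithTop ℕ∞) X] [T2Space X] [SecondCountableTopology X] [ConnectedSpace X], let P : Literature.Geometry.Lorentzian.InitialDataSet (𝓡 3) X → Prop := fun D ↦ (∃ 𝒟 : Literature.Geometry.Lorentzian.VacuumCauchyDevelopment D, 𝒟.IsMaximal) ∧ ∀ 𝒟 : Literature.Geometry.Lorentzian.VacuumCauchyDevelopment D, 𝒟.IsMaximal → Summit.FinalStateConjecture.HasCompleteNullInfinity 𝒟.toCauchyDevelopment ∧ ∃ (O : Set 𝒟.carrier) (d : Literature.Geometry.Lorentzian.FinalStateDecomposition 𝒟.toSpacetime O 2), (∀ i, Literature.Geometry.Lorentzian.Kerr.IsSubextremal (d.mass i) (d.spin i)) ∧ O = Summit.FinalStateConjecture.exteriorOf 𝒟.toCauchyDevelopment d.charted ∧ Summit.FinalStateConjecture.RaysStayInClosure 𝒟.toCauchyDevelopment O ∧ Summit.FinalStateConjecture.HasExhaustiveCharts d ∧ Summit.FinalStateConjecture.IsFutureOriented d; let P0 : Literature.Geometry.Lorentzian.InitialDataSet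 (𝓡 3) X → Prop := fun D ↦ (∃ 𝒟 : Literature.Geometry.Lorentzian.VacuumCauchyDevelopment D, 𝒟.IsMaximal) ∧ ∀ 𝒟 : Literature.Geometry.Lorentzian.VacuumCauchyDevelopment D, 𝒟.IsMaximal → Summit.FinalStateConjecture.HasCompleteNullInfinity 𝒟.toCauchyDevelopment ∧ ∃ (O : Set 𝒟.carrier) (d : Literature.Geometry.Lorentzian.FinalStateDecomposition 𝒟.toSpacetime O 2), d.N = 0 ∧ (∀ i, Literature.Geometry.Lorentzian.Kerr.IsSubextremal (d.mass i) (d.spin i)) ∧ O = Summit.FinalStateConjecture.exteriorOf 𝒟.toCauchyDevelopment d.charted ∧ Summit.FinalStateConjecture.RaysStayInClosure 𝒟.toCauchyDevelopment O ∧ Summit.FinalStateConjecture.HasExhaustiveCharts d ∧ Summit.FinalStateConjecture.IsFutureOriented d; let AdhP : Literature.Geometry.Lorentzian.InitialDataSet (𝓡 3) X → Prop := fun d ↦ ∃ (e : Literature.Geometry.Lorentzian.AFEnd X) (F : EuclideanSpace ℝ (Fin 1) → Literature.Geometry.Lorentzian.InitialDataSet (𝓡 3) X), Literature.Geometry.Lorentzian.InitialDataSet.IsTameDataFamily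 e 1 F ∧ Literature.Geometry.Lorentzian.InitialDataSet.IsImmersedAtZero 1 F ∧ F 0 = d ∧ (∀ c, F c ∈ Literature.Geometry.Lorentzian.admissibleVacuumData X) ∧ ∃ᶠ c in 𝓝[≠] (0 : EuclideanSpace ℝ (Fin 1)), P (F c); let Adh0 : Literature.Geometry.Lorentzian.InitialDataSet (𝓡 3) X → Prop := fun d ↦ ∃ (e : Literature.Geometry.Lorentzian.AFEnd X) (F : EuclideanSpace ℝ (Fin 1) → Literature.Geometry.Lorentzian.InitialDataSet (𝓡 3) X), Literature.Geometry.Lorentzian.InitialDataSet.IsTameDataFamily e 1 F ∧ Literature.Geometry.Lorentzian.InitialDataSet.IsImmersedAtZero 1 F ∧ F 0 = d ∧ (∀ c, F c ∈ Literature.Geometry.Lorentzian.admissibleVacuumData X) ∧ ∃ᶠ c in 𝓝[≠] (0 : EuclideanSpace ℝ (Fin 1)), P0 (F c); ∀ d ∈ Literature.Geometry.Lorentzian.admissibleVacuumData X, ¬ P d → (AdhP d ∧ ¬ Adh0 d) → ∃ (e : Literature.Geometry.Lorentzian.AFEnd X) (F : EuclideanSpace ℝ (Fin 1) → Literature.Geometry.Lorentzian.InitialDataSet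 (𝓡 3) X), Literature.Geometry.Lorentzian.InitialDataSet.IsTameDataFamily e 1 F ∧ Literature.Geometry.Lorentzian.InitialDataSet.IsImmersedAtZero 1 F ∧ F 0 = d ∧ Injective F ∧ (∀ c, F c ∈ Literature.Geometry.Lorentzian.admissibleVacuumData X) ∧ ∀ c ≠ 0, P (F c)

-- parent: SettlingAdherentCurable · child (gen 1)
/--     item stmt-FinalStateConjecture-25216 · crux · rank 401 · open
    parent: SettlingAdherentCurable · by planner
    why it might fail: a zoom–whirl / merge–scatter threshold with Cantor-like structure in the tame topology (Pretorius–Khurana), or naked-singularity data whose robustly collapsing neighbours accumulate only along laminated parameter sets (route LaminatedThreshold crux A).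
    sources: Christodoulou1999, arXiv:gr-qc/0702084, arXiv:2104.11857, arXiv:2402.10190
[crux · gen-2 glued split of SettlingAdherentCurable (stmt-24910), lens-4 g2 node
RemnantGradedThresholds; WEAKER·NEW RESIDUAL near-wholesale; INTERNAL NODE
(censorship-after-trapping / capture / rigidity at BOUNDED extremality |a| ≤ χ'M); road
SmoothRobustThreshold outside closes] For every Σ and every admissible P_Σ-exceptional datum d which
is a tame limit of (χ, m)-ROBUSTLY settling admissible data for some χ < 1, m > 0 (remnant spin
ratios ≤ χ, masses ≥ m accumulate along some tame immersed admissible curve based at d) but NOT a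
tame limit of dispersing (N = 0) data, there are one end e and a tame immersed injective admissible
one-parameter family F with F 0 = d whose members c ≠ 0 satisfy P_Σ. -/
@[route_item "route-FinalStateConjecture-RootDecompAdjacencyCells"]
def RobustThresholdCurable : Prop :=
  ∀ (X : Type) [TopologicalSpace X] [ChartedSpace Literature.Geometry.Lorentzian.E3 X] [IsManifold (𝓡 3) ((⊤ : ℕ∞) : WithTop ℕ∞) X] [T2Space X] [SecondCountableTopology X] [ConnectedSpace X], let P : Literature.Geometry.Lorentzian.InitialDataSet (𝓡 3) X → Prop := fun D ↦ (∃ 𝒟 : Literature.Geometry.Lorentzian.VacuumCauchyDevelopment D, 𝒟.IsMaximal) ∧ ∀ 𝒟 : Literature.Geometry.Lorentzian.VacuumCauchyDevelopment D, 𝒟.IsMaximal → Summit.FinalStateConjecture.HasCompleteNullInfinity 𝒟.toCauchyDevelopment ∧ ∃ (O : Set 𝒟.carrier) (d : Literature.Geometry.Lorentzian.FinalStateDecomposition 𝒟.toSpacetime O 2), (∀ i, Literature.Geometry.Lorentzian.Kerr.IsSubextremal (d.mass i) (d.spin i)) ∧ O = Summit.FinalStateConjecture.exteriorOf 𝒟.toCauchyDevelopment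 d.charted ∧ Summit.FinalStateConjecture.RaysStayInClosure 𝒟.toCauchyDevelopment O ∧ Summit.FinalStateConjecture.HasExhaustiveCharts d ∧ Summit.FinalStateConjecture.IsFutureOriented d; let P0 : Literature.Geometry.Lorentzian.InitialDataSet (𝓡 3) X → Prop := fun D ↦ (∃ 𝒟 : Literature.Geometry.Lorentzian.VacuumCauchyDevelopment D, 𝒟.IsMaximal) ∧ ∀ 𝒟 : Literature.Geometry.Lorentzian.VacuumCauchyDevelopment D, 𝒟.IsMaximal → Summit.FinalStateConjecture.HasCompleteNullInfinity 𝒟.toCauchyDevelopment ∧ ∃ (O : Set 𝒟.carrier) (d : Literature.Geometry.Lorentzian.FinalStateDecomposition 𝒟.toSpacetime O 2), d.N = 0 ∧ (∀ i, Literature.Geometry.Lorentzian.Kerr.IsSubextremal (d.mass i) (d.spin i)) ∧ O = Summit.FinalStateConjecture.exteriorOf 𝒟.toCauchyDevelopment d.charted ∧ Summit.FinalStateConjecture.RaysStayInClosure 𝒟.toCauchyDevelopment O ∧ Summit.FinalStateConjecture.HasExhaustiveCharts d ∧ Summit.FinalStateConjecture.IsFutureOriented d; let Adh0 : Literature.Geometry.Lorentzian.InitialDataSet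 (𝓡 3) X → Prop := fun d ↦ ∃ (e : Literature.Geometry.Lorentzian.AFEnd X) (F : EuclideanSpace ℝ (Fin 1) → Literature.Geometry.Lorentzian.InitialDataSet (𝓡 3) X), Literature.Geometry.Lorentzian.InitialDataSet.IsTameDataFamily e 1 F ∧ Literature.Geometry.Lorentzian.InitialDataSet.IsImmersedAtZero 1 F ∧ F 0 = d ∧ (∀ c, F c ∈ Literature.Geometry.Lorentzian.admissibleVacuumData X) ∧ ∃ᶠ c in 𝓝[≠] (0 : EuclideanSpace ℝ (Fin 1)), P0 (F c); let Rob : ℝ → ℝ → Literature.Geometry.Lorentzian.InitialDataSet (𝓡 3) X → Prop := fun χ m D ↦ P D ∧ ∃ 𝒟 : Literature.Geometry.Lorentzian.VacuumCauchyDevelopment D, 𝒟.IsMaximal ∧ ∃ (O : Set 𝒟.carrier) (d : Literature.Geometry.Lorentzian.FinalStateDecomposition 𝒟.toSpacetime O 2), (∀ i, Literature.Geometry.Lorentzian.Kerr.IsSubextremal (d.mass i) (d.spin i)) ∧ O = Summit.FinalStateConjecture.exteriorOf 𝒟.toCauchyDevelopment d.charted ∧ Summit.FinalStateConjecture.RaysStayInClosure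 𝒟.toCauchyDevelopment O ∧ Summit.FinalStateConjecture.HasExhaustiveCharts d ∧ Summit.FinalStateConjecture.IsFutureOriented d ∧ ∀ i, |d.spin i| ≤ χ * d.mass i ∧ m ≤ d.mass i; let AdhRob : Literature.Geometry.Lorentzian.InitialDataSet (𝓡 3) X → Prop := fun d ↦ ∃ χ : ℝ, χ < 1 ∧ ∃ m : ℝ, 0 < m ∧ ∃ (e : Literature.Geometry.Lorentzian.AFEnd X) (F : EuclideanSpace ℝ (Fin 1) → Literature.Geometry.Lorentzian.InitialDataSet (𝓡 3) X), Literature.Geometry.Lorentzian.InitialDataSet.IsTameDataFamily e 1 F ∧ Literature.Geometry.Lorentzian.InitialDataSet.IsImmersedAtZero 1 F ∧ F 0 = d ∧ (∀ c, F c ∈ Literature.Geometry.Lorentzian.admissibleVacuumData X) ∧ ∃ᶠ c in 𝓝[≠] (0 : EuclideanSpace ℝ (Fin 1)), Rob χ m (F c); ∀ d ∈ Literature.Geometry.Lorentzian.admissibleVacuumData X, ¬ P d → (AdhRob d ∧ ¬ Adh0 d) → ∃ (e : Literature.Geometry.Lorentzian.AFEnd X) (F : EuclideanSpace ℝ (Fin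 1) → Literature.Geometry.Lorentzian.InitialDataSet (𝓡 3) X), Literature.Geometry.Lorentzian.InitialDataSet.IsTameDataFamily e 1 F ∧ Literature.Geometry.Lorentzian.InitialDataSet.IsImmersedAtZero 1 F ∧ F 0 = d ∧ Injective F ∧ (∀ c, F c ∈ Literature.Geometry.Lorentzian.admissibleVacuumData X) ∧ ∀ c ≠ 0, P (F c)

-- parent: SettlingAdherentCurable · child (gen 1)
/--     item stmt-FinalStateConjecture-25217 · crux · rank 402 · open
    parent: SettlingAdherentCurable · by planner
    why it might fail: at a vacuum extremal wall not adjacent to dispersion (third-law / overspinning threshold) the only settling neighbours are near-extremal and the Aretakis instability may make the settling side fail to be one-sidedly tame-open, leaving no punctured curve of settling data.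
    sources: arXiv:2402.10190, arXiv:2601.20955, arXiv:1110.2007, arXiv:2211.15742
[crux · gen-2 glued split of SettlingAdherentCurable (stmt-24910), lens-4 g2; WEAKER·thin·BARRIER
(AretakisInstability declared inside); leaf IDEA-NEEDED + INSTRUMENTABLE (census T-X1 max remnant
spin in one-ended vacuum collapse; T-X2 EMCSF extremal leaves); registered statement in its
direction stmt-FinalStateConjecture-10606 PhaseMixingCapture.NearExtremalKappaCapture cited by name;
lens kernel certificates exists_nearExtremal_remnant_of_adhMacro, not_adhMacro_of_gap] For every Σ
and every admissible P_Σ-exceptional datum d which is a tame limit of settling admissible data but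
of NO robust class G_(χ,m) (χ < 1, m > 0) — along every admissible tame curve through d the settling
members' remnants extremalise (|aᵢ|/Mᵢ → 1) or evanesce (Mᵢ → 0) — there are one end e and a tame
immersed injective admissible one-parameter family F with F 0 = d whose members c ≠ 0 satisfy P_Σ. -/
@[route_item "route-FinalStateConjecture-RootDecompAdjacencyCells"]
def DegenerateThresholdCurable : Prop :=
  ∀ (X : Type) [TopologicalSpace X] [ChartedSpace Literature.Geometry.Lorentzian.E3 X] [IsManifold (𝓡 3) ((⊤ : ℕ∞) : WithTop ℕ∞) X] [T2Space X] [SecondCountableTopology X] [ConnectedSpace X], let P : Literature.Geometry.Lorentzian.InitialDataSet (𝓡 3) X → Prop := fun D ↦ (∃ 𝒟 : Literature.Geometry.Lorentzian.VacuumCauchyDevelopment D, 𝒟.IsMaximal) ∧ ∀ 𝒟 : Literature.Geometry.Lorentzian.VacuumCauchyDevelopment D, 𝒟.IsMaximal → Summit.FinalStateConjecture.HasCompleteNullInfinity 𝒟.toCauchyDevelopment ∧ ∃ (O : Set 𝒟.carrier) (d : Literature.Geometry.Lorentzian.FinalStateDecomposition 𝒟.toSpacetime O 2), (∀ i, Literature.Geometry.Lorentzian.Kerr.IsSubextremal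 (d.mass i) (d.spin i)) ∧ O = Summit.FinalStateConjecture.exteriorOf 𝒟.toCauchyDevelopment d.charted ∧ Summit.FinalStateConjecture.RaysStayInClosure 𝒟.toCauchyDevelopment O ∧ Summit.FinalStateConjecture.HasExhaustiveCharts d ∧ Summit.FinalStateConjecture.IsFutureOriented d; let AdhP : Literature.Geometry.Lorentzian.InitialDataSet (𝓡 3) X → Prop := fun d ↦ ∃ (e : Literature.Geometry.Lorentzian.AFEnd X) (F : EuclideanSpace ℝ (Fin 1) → Literature.Geometry.Lorentzian.InitialDataSet (𝓡 3) X), Literature.Geometry.Lorentzian.InitialDataSet.IsTameDataFamily e 1 F ∧ Literature.Geometry.Lorentzian.InitialDataSet.IsImmersedAtZero 1 F ∧ F 0 = d ∧ (∀ c, F c ∈ Literature.Geometry.Lorentzian.admissibleVacuumData X) ∧ ∃ᶠ c in 𝓝[≠] (0 : EuclideanSpace ℝ (Fin 1)), P (F c); let Rob : ℝ → ℝ → Literature.Geometry.Lorentzian.InitialDataSet (𝓡 3) X → Prop := fun χ m D ↦ P D ∧ ∃ 𝒟 : Literature.Geometry.Lorentzian.VacuumCauchyDevelopment D, 𝒟.IsMaximal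 ∧ ∃ (O : Set 𝒟.carrier) (d : Literature.Geometry.Lorentzian.FinalStateDecomposition 𝒟.toSpacetime O 2), (∀ i, Literature.Geometry.Lorentzian.Kerr.IsSubextremal (d.mass i) (d.spin i)) ∧ O = Summit.FinalStateConjecture.exteriorOf 𝒟.toCauchyDevelopment d.charted ∧ Summit.FinalStateConjecture.RaysStayInClosure 𝒟.toCauchyDevelopment O ∧ Summit.FinalStateConjecture.HasExhaustiveCharts d ∧ Summit.FinalStateConjecture.IsFutureOriented d ∧ ∀ i, |d.spin i| ≤ χ * d.mass i ∧ m ≤ d.mass i; let AdhRob : Literature.Geometry.Lorentzian.InitialDataSet (𝓡 3) X → Prop := fun d ↦ ∃ χ : ℝ, χ < 1 ∧ ∃ m : ℝ, 0 < m ∧ ∃ (e : Literature.Geometry.Lorentzian.AFEnd X) (F : EuclideanSpace ℝ (Fin 1) → Literature.Geometry.Lorentzian.InitialDataSet (𝓡 3) X), Literature.Geometry.Lorentzian.InitialDataSet.IsTameDataFamily e 1 F ∧ Literature.Geometry.Lorentzian.InitialDataSet.IsImmersedAtZero 1 F ∧ F 0 = d ∧ (∀ c, F c ∈ Literature.Geometry.Lorentzian.admissibleVacuumData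 X) ∧ ∃ᶠ c in 𝓝[≠] (0 : EuclideanSpace ℝ (Fin 1)), Rob χ m (F c); ∀ d ∈ Literature.Geometry.Lorentzian.admissibleVacuumData X, ¬ P d → (AdhP d ∧ ¬ AdhRob d) → ∃ (e : Literature.Geometry.Lorentzian.AFEnd X) (F : EuclideanSpace ℝ (Fin 1) → Literature.Geometry.Lorentzian.InitialDataSet (𝓡 3) X), Literature.Geometry.Lorentzian.InitialDataSet.IsTameDataFamily e 1 F ∧ Literature.Geometry.Lorentzian.InitialDataSet.IsImmersedAtZero 1 F ∧ F 0 = d ∧ Injective F ∧ (∀ c, F c ∈ Literature.Geometry.Lorentzian.admissibleVacuumData X) ∧ ∀ c ≠ 0, P (F c)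

-- parent: SettlingAdherentCurable · glue (gen 1)
/--     item stmt-FinalStateConjecture-25218 · support · rank 403 · open
    parent: SettlingAdherentCurable · GLUE: children ⟹ parent · by planner
RobustThresholdCurable → DegenerateThresholdCurable → SettlingAdherentCurable (pure logic: excluded
middle on robust adherence AdhRob d inside the parent cell AdhP d ∧ ¬Adh0 d; writer kernel proof
settlingAdherentCurable_of_split + exactness split_iff in folder/n4g2/Sketch.lean, lens kernel
HOME/decomp-fsc-lens-4/RemnantGradedThresholds.lean @55c3ddf0) -/
@[route_item "route-FinalStateConjecture-RootDecompAdjacencyCells"]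
def SettlingAdherentCurableGlue : Prop :=
  RobustThresholdCurable → DegenerateThresholdCurable → SettlingAdherentCurable

/-- item stmt-FinalStateConjecture-24911 · assembly · rank 1 · open · by planner
sources: Christodoulou1999
[assembly] SettlingAdherentCurable → DispersiveThresholdCurable → NoStableCounterexample → the final
state conjecture as typed. -/
@[route_item "route-FinalStateConjecture-RootDecompAdjacencyCells"]
def Assembly : Prop :=
  SettlingAdherentCurable → DispersiveThresholdCurable → NoStableCounterexample → FinalStateConjecture

/-! D-0027 §2.1 — DECIDING THEOREM (planner-authored via `route open/edit --closes-file`; by planner-decomp-fsc-writer-1-g0-0 2026-08-30T02:11:18Z):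
its hypotheses are this route's items and its conclusion the sub-problem Statement (glue_lint), and it elaborates with this file. -/

@[closes "route-FinalStateConjecture-RootDecompAdjacencyCells"] theorem closes (hII : SettlingAdherentCurable) (hI : DispersiveThresholdCurable) (hIII : NoStableCounterexample) : FinalStateConjecture := by
  intro X _ _ _ _ _ _ d hd
  suffices h : ∃ (e : Literature.Geometry.Lorentzian.AFEnd X) (F : EuclideanSpace ℝ (Fin 1) → Literature.Geometry.Lorentzian.InitialDataSet (𝓡 3) X), Literature.Geometry.Lorentzian.InitialDataSet.IsTameDataFamily e 1 F ∧ Literature.Geometry.Lorentzian.InitialDataSet.IsImmersedAtZero 1 F ∧ F 0 = d ∧ Injective F ∧ (∀ c, F c ∈ Literature.Geometry.Lorentzian.admissibleVacuumData X) ∧ ∀ c ≠ 0, ((∃ 𝒟 : Literature.Geometry.Lorentzian.VacuumCauchyDevelopment (F c), 𝒟.IsMaximal) ∧ ∀ 𝒟 : Literature.Geometry.Lorentzian.VacuumCauchyDevelopment (F c), 𝒟.IsMaximal → Summit.FinalStateConjecture.HasCompleteNullInfinity 𝒟.toCauchyDevelopment ∧ ∃ (O : Set 𝒟.carrier) (d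 : Literature.Geometry.Lorentzian.FinalStateDecomposition 𝒟.toSpacetime O 2), (∀ i, Literature.Geometry.Lorentzian.Kerr.IsSubextremal (d.mass i) (d.spin i)) ∧ O = Summit.FinalStateConjecture.exteriorOf 𝒟.toCauchyDevelopment d.charted ∧ Summit.FinalStateConjecture.RaysStayInClosure 𝒟.toCauchyDevelopment O ∧ Summit.FinalStateConjecture.HasExhaustiveCharts d ∧ Summit.FinalStateConjecture.IsFutureOriented d) by
    obtain ⟨e, F, h1, h2, h3, h4, h5, h6⟩ := h
    exact ⟨e, F, h1, h2, h3, h4, h5, fun c hc hmem ↦ hmem.2 (h6 c hc)⟩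
  have hadh := hIII X d hd.1 hd.2
  by_cases h0 : ∃ (e : Literature.Geometry.Lorentzian.AFEnd X) (F : EuclideanSpace ℝ (Fin 1) → Literature.Geometry.Lorentzian.InitialDataSet (𝓡 3) X), Literature.Geometry.Lorentzian.InitialDataSet.IsTameDataFamily e 1 F ∧ Literature.Geometry.Lorentzian.InitialDataSet.IsImmersedAtZero 1 F ∧ F 0 = d ∧ (∀ c, F c ∈ Literature.Geometry.Lorentzian.admissibleVacuumData X) ∧ ∃ᶠ c in 𝓝[≠] (0 : EuclideanSpace ℝ (Fin 1)), ((∃ 𝒟 : Literature.Geometry.Lorentzian.VacuumCauchyDevelopment (F c), 𝒟.IsMaximal) ∧ ∀ 𝒟 : Literature.Geometry.Lorentzian.VacuumCauchyDevelopment (F c), 𝒟.IsMaximal → Summit.FinalStateConjecture.HasCompleteNullInfinity 𝒟.toCauchyDevelopment ∧ ∃ (O : Set 𝒟.carrier) (d : Literature.Geometry.Lorentzian.FinalStateDecomposition 𝒟.toSpacetime O 2), d.N = 0 ∧ (∀ i, Literature.Geometry.Lorentzian.Kerr.IsSubextremal (d.mass i) (d.spin i)) ∧ O = Summit.FinalStateConjecture.exteriorOf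 𝒟.toCauchyDevelopment d.charted ∧ Summit.FinalStateConjecture.RaysStayInClosure 𝒟.toCauchyDevelopment O ∧ Summit.FinalStateConjecture.HasExhaustiveCharts d ∧ Summit.FinalStateConjecture.IsFutureOriented d)
  · exact hI X d hd.1 hd.2 h0
  · exact hII X d hd.1 hd.2 ⟨hadh, h0⟩

end Summit.FinalStateConjecture.FinalStateConjecture.Theses.RootDecompAdjacencyCells
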